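import Summits.QuantumFields.BalabanUV.Beta.GAN24.MonotoneTorusHodge
import Literature.MathematicalPhysics.QuantumFieldTheory.Balaban1983to89.B5DivOrth

/-!
# Beta / GAN24 / MonotoneTorusBlockMean — readings with BLOCK-CONSTANT DIVERGENCE (asym1's `Π_bm` currency, SKELETON-P4 §5 exit (iv′)) are legitimate
# read sources on the torus, and their canonical read-outs of Bałaban's block-constrained covariance are Loewner-antitone under refinement
# (gan24-p4 gen 3, companion of `GAN24/MonotoneTorusHodge`; BINDER-OWNERS row G-an2-4 ∕ (CONV-C), ALTERNATIVE DISCHARGE «rate OR monotonicity»; NOT IN PRINT — our proof attempt)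

HONEST FRAMING (page 1 of everything the β sub-cell writes): discharging `BetaPertH` makes Bałaban's UV stability UNCONDITIONAL — a
real constructive-QFT result; it is NOT the continuum limit and NOT the Clay problem.  HONEST DEPENDENCY (cell reorg 2026-08-19, verbatim):
«continuum YM on T⁴ ⇐ BetaPertH ∧ nine spine estimates (0/9 proved); BetaPertH ⇐ (D1) ∧ (D4) ∧ CAP+tail; G-an2-4 gates asym, D1 and NE2/3/4.»
HONEST LABEL: «not in print; our proof attempt; alternative discharge of the G-an2-4 row (rate OR monotonicity)»; 0 wall binders instantiated.
ABSOLUTE RULE honoured: nothing cited; [folklore] over `GAN24/MonotoneTorusHodge` (discrete Poincaré lemma, (1.20) BY NAME), `B5DivOrth.sum_GradOp_adjoint`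
(«∂*A is orthogonal to constant functions», kernel-proved there) and `B5Block118.QsOp_mulVec`.

## WHAT IS PROVED (read-out torus `fine Lc M₀` over a unit torus `Tor M₀`, unit-block rows `R = QvOp Lc M₀`, every `d`, `Lc ≥ 1`)
* `const_of_gradOp_eq_zero` — the torus is connected: `∂f = 0 ⟹ f ≡ f(0)` (Fourier route of `MonotoneTorusHodge` §1).
* `QsOp_mulVec_one`, `sum_QsOp_conjTranspose_mulVec` — `Q′1 = 1`, `Σ_x (Q′ᴴψ)(x) = Σ_y ψ(y)`.
* **`blockMeanDiv_source_legit`**: a test form `t` with `∂ᴴ t = Q′ᴴ ψ` (divergence constant on the unit blocks — in particular every co-closed `t`, `ψ = 0`) is orthogonal to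
  `sread j z` for every level-`j` field `z` with `rows R j z = 0`, `hform j z = 0`.
* **`blockMeanDiv_readOut_antitone`**: for every test-form matrix `T` with `∂ᴴ Tᴴ = Q′ᴴ Ψ`, the canonical read-outs `(T·sread j)·critCov (hform j) (rows R j)·(T·sread j)ᴴ` satisfy
  `(P j − P (j+1)).PosSemidef` for all `j` — exit (iv′) of SKELETON-P4 §5 as a theorem on tori (gen 2 proved the abstract form `MonotoneCoarsenReadOut.readOut_chain_step_of_kkt_legit`
  modulo fibrewise instantiation; here NO gauge slice, NO KKT rows, NO legitimacy count is needed: the gauge-free `critCov` and the Poincaré lemma replace them).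
SCOPE (honest): torus avatar, abelian∕linearised layer, unit-block constraints exactly; NOT an2's ℤ^{d+1} system; NOT BetaPertH, NOT continuum, NOT Clay.
-/

noncomputable section

namespace Summit.QuantumFields.BalabanUV.Beta.GAN24.MonotoneTorusBlockMean

open Matrix Finset
open scoped BigOperators ComplexOrder ComplexConjugate
open Literature.MathematicalPhysics.QuantumFieldTheory.Balaban1983to89
open Literature.MathematicalPhysics.QuantumFieldTheory.Balaban1983to89.B5Prop11Plancherel (Tor fine unitVec chi chi_zero_left)
open Literature.MathematicalPhysics.QuantumFieldTheory.Balaban1983to89.B5Action121 (GradOp GradOp_mulVec sdiff_mulVec)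
open Literature.MathematicalPhysics.QuantumFieldTheory.Balaban1983to89.B5Block118 (QvOp QsOp QsOp_mulVec)
open Literature.MathematicalPhysics.QuantumFieldTheory.Balaban1983to89.B5DivOrth (sum_GradOp_adjoint)
open Summit.QuantumFields.BalabanUV.Beta.GAN24.MonotoneCoarsen (IsCrit conj_pairing)
open Summit.QuantumFields.BalabanUV.Beta.GAN24.MonotoneCritical (critCov critCov_conjTranspose isCrit_critCov)
open Summit.QuantumFields.BalabanUV.Beta.GAN24.MonotoneTorusTower (Lev sread rows hform hform_isHermitian hform_posSemidef readOut_chain_torus)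
open Summit.QuantumFields.BalabanUV.Beta.GAN24.MonotoneTorusPlaquette (plaq_eq_zero_of_hform_mulVec)
open Summit.QuantumFields.BalabanUV.Beta.GAN24.MonotoneTorusHodge (fcoef sum_conj_chi_shift exists_omega_ne_zero sum_chi_mul_fcoef
  exists_potential_of_plaq_eq_zero QvOp_mulVec_const QvOp_mulVec_gradOp sum_gradOp_eq_zero)

variable {d : ℕ}

/-! ## Block-constant divergence -/

section BlockMean


variable (N : Fin d → ℕ) [hN : ∀ μ, NeZero (N μ)]

/-- **THE TORUS IS CONNECTED**: a scalar function invariant under every unit step is constant (`∂f = 0 ⟹ f ≡ f(0)`) — by the Fourier route of §1: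
`f̂(p)(χ_μ(p) − 1) = 0` kills every `p ≠ 0`. [folklore] -/
theorem const_of_gradOp_eq_zero (f : Tor N → ℂ) (hf : GradOp N 1 *ᵥ f = 0) (y : Tor N) : f y = f 0 := by
  classical
  -- view `f` as a 1-form constant in the direction index and reuse §1
  set z : Tor N × Fin d → ℂ := fun b => f b.1 with hz
  have hstep : ∀ (x : Tor N) (μ : Fin d), f (x + unitVec N μ) = f x := by
    intro x μ
    have h := congrFun hf (x, μ)
    rw [GradOp_mulVec, sdiff_mulVec, one_mul, Pi.zero_apply, sub_eq_zero] at h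
    exact h
  by_cases hd : d = 0
  · subst hd
    have : y = 0 := funext fun μ => Fin.elim0 μ
    rw [this]
  obtain ⟨μ₀⟩ : Nonempty (Fin d) := Fin.pos_iff_nonempty.mp (Nat.pos_of_ne_zero hd)
  -- all nonzero Fourier coefficients vanish
  have hcoef : ∀ p : Tor N, p ≠ 0 → fcoef N z μ₀ p = 0 := by
    intro p hp
    obtain ⟨μ, hμ⟩ := exists_omega_ne_zero N hp
    have hsh := sum_conj_chi_shift N z μ₀ p (unitVec N μ)
    have e : ∑ x : Tor N, conj (chi N p x) * z (x + unitVec N μ, μ₀) = fcoef N z μ₀ p := by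
      unfold fcoef
      exact Finset.sum_congr rfl fun x _ => by rw [hz]; exact congrArg _ (hstep x μ)
    rw [e] at hsh
    have h2 : (chi N p (unitVec N μ) - 1) * fcoef N z μ₀ p = 0 := by linear_combination (-1 : ℂ) * hsh
    exact (mul_eq_zero.mp h2).resolve_left hμ
  -- inversion at `y` and at `0`
  have hcard : (Fintype.card (Tor N) : ℂ) ≠ 0 := Nat.cast_ne_zero.mpr Fintype.card_ne_zero
  have hinv : ∀ x : Tor N, (Fintype.card (Tor N) : ℂ) * f x = fcoef N z μ₀ 0 := by
    intro x
    rw [show f x = z (x, μ₀) from rfl, ← sum_chi_mul_fcoef N z μ₀ x, Finset.sum_eq_single (0 : Tor N)]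
    · rw [chi_zero_left, one_mul]
    · intro p _ hp; rw [hcoef p hp, mul_zero]
    · intro h; exact absurd (Finset.mem_univ _) h
  exact mul_left_cancel₀ hcard ((hinv y).trans (hinv 0).symm)

variable (n : ℕ) [NeZero n] (M : Fin d → ℕ) [hM : ∀ μ, NeZero (M μ)]

/-- The rows of `Q′_n` sum to one: `Q′_n 1 = 1`. [folklore] -/
theorem QsOp_mulVec_one (y : Tor M) : (QsOp n M *ᵥ fun _ => (1 : ℂ)) y = 1 := by
  rw [QsOp_mulVec]
  simp only [Finset.sum_const, Finset.card_univ, Fintype.card_fun, Fintype.card_fin, nsmul_eq_mul, mul_one]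
  have hn : (n : ℂ) ≠ 0 := by exact_mod_cast NeZero.ne n
  push_cast
  field_simp

/-- A block-constant function sums to the sum of its block values: `Σ_x (Q′ᴴ ψ)(x) = Σ_y ψ(y)`. [folklore] -/
theorem sum_QsOp_conjTranspose_mulVec (ψ : Tor M → ℂ) : ∑ x : Tor (fine n M), ((QsOp n M)ᴴ *ᵥ ψ) x = ∑ y : Tor M, ψ y := by
  simp only [mulVec, dotProduct, conjTranspose_apply]
  rw [Finset.sum_comm]
  refine Finset.sum_congr rfl fun y _ => ?_
  rw [← Finset.sum_mul]
  have h1 : ∑ x : Tor (fine n M), QsOp n M y x = 1 := by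
    have h := QsOp_mulVec_one n M y
    simpa [mulVec, dotProduct] using h
  rw [← star_sum, h1, star_one, one_mul]

variable (Lc : ℕ) [NeZero Lc] (M₀ : Fin d → ℕ) [hM₀ : ∀ μ, NeZero (M₀ μ)]

/-- **BLOCK-CONSTANT DIVERGENCE ⟹ LEGITIMATE** (exit (iv′) of SKELETON-P4 §5 on tori; asym1's `Π_bm` readings).  Read-out torus `fine Lc M₀`, unit-block rows
`R = QvOp Lc M₀`; a test form `t` whose divergence is constant on the unit blocks, `∂ᴴ t = Q′ᴴ ψ`.  Then `⟨z, (sread j)ᴴ t⟩ = 0` for every level-`j` field `z` with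
`rows R j z = 0`, `hform j z = 0`.  Route: as `transverse_source_legit`, plus: the unit-block means of the potential are CONSTANT (`const_of_gradOp_eq_zero` on `Tor M₀`) and
`Σ_y ψ(y) = Σ_x (∂ᴴt)(x) = 0`. [folklore] -/
theorem blockMeanDiv_source_legit (t : Tor (fine Lc M₀) × Fin d → ℂ) (ψ : Tor M₀ → ℂ)
    (ht : (GradOp (fine Lc M₀) 1)ᴴ *ᵥ t = (QsOp Lc M₀)ᴴ *ᵥ ψ) (j : ℕ) (z : Lev Lc (fine Lc M₀) j → ℂ)
    (hR : rows Lc (fine Lc M₀) (QvOp Lc M₀) j *ᵥ z = 0) (hH : hform Lc (fine Lc M₀) j *ᵥ z = 0) :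
    star z ⬝ᵥ ((sread Lc (fine Lc M₀) j)ᴴ *ᵥ t) = 0 := by
  classical
  have hz := plaq_eq_zero_of_hform_mulVec Lc (fine Lc M₀) j z hH
  obtain ⟨lam, h, hdec⟩ := exists_potential_of_plaq_eq_zero (fine (Lc ^ j) (fine Lc M₀)) z hz
  have hzeq : z = GradOp (fine (Lc ^ j) (fine Lc M₀)) 1 *ᵥ lam + fun b => h b.2 := by
    funext b
    obtain ⟨x, μ⟩ := b
    rw [Pi.add_apply, GradOp_mulVec, sdiff_mulVec, one_mul, hdec]
  set κ : Tor (fine Lc M₀) → ℂ := QsOp (Lc ^ j) (fine Lc M₀) *ᵥ ((1 / ((Lc ^ j : ℕ) : ℂ)) • lam) with hκ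
  have hsz : sread Lc (fine Lc M₀) j *ᵥ z = GradOp (fine Lc M₀) 1 *ᵥ κ + fun b => h b.2 := by
    unfold sread
    rw [hzeq, mulVec_add, QvOp_mulVec_gradOp, QvOp_mulVec_const]
  have hrow : QvOp Lc M₀ *ᵥ (GradOp (fine Lc M₀) 1 *ᵥ κ + fun b => h b.2) = 0 := by
    rw [← hsz]
    unfold rows at hR
    rwa [← mulVec_mulVec] at hR
  rw [mulVec_add, QvOp_mulVec_gradOp, QvOp_mulVec_const] at hrow
  have hh : ∀ μ, h μ = 0 := by
    intro μ
    have hs := congrArg (fun w : Tor M₀ × Fin d → ℂ => ∑ y : Tor M₀, w (y, μ)) hrow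
    simp only [Pi.add_apply, Pi.zero_apply, Finset.sum_add_distrib, sum_gradOp_eq_zero, zero_add, Finset.sum_const,
      Finset.card_univ, nsmul_eq_mul, mul_zero] at hs
    have hc : (Fintype.card (Tor M₀) : ℂ) ≠ 0 := Nat.cast_ne_zero.mpr Fintype.card_ne_zero
    exact (mul_eq_zero.mp hs).resolve_left hc
  have hconst : (fun b : Tor (fine Lc M₀) × Fin d => h b.2) = 0 := by
    funext b; exact hh b.2
  have hconst₀ : (fun b : Tor M₀ × Fin d => h b.2) = 0 := by
    funext b; exact hh b.2
  rw [hconst₀, add_zero] at hrow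
  rw [hconst, add_zero] at hsz
  -- the unit-block means of the potential are constant
  set κ' : Tor M₀ → ℂ := QsOp Lc M₀ *ᵥ ((1 / (Lc : ℂ)) • κ) with hκ'
  have hκc : ∀ y, κ' y = κ' 0 := const_of_gradOp_eq_zero M₀ κ' hrow
  -- `Σ_y ψ(y) = 0`
  have hψ : ∑ y : Tor M₀, ψ y = 0 := by
    rw [← sum_QsOp_conjTranspose_mulVec Lc M₀ ψ, ← ht]
    exact sum_GradOp_adjoint (fine Lc M₀) 1 t
  -- `Q′ κ = Lc · κ'` is the constant `Lc κ'(0)`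
  have hL : (Lc : ℂ) ≠ 0 := by exact_mod_cast NeZero.ne Lc
  have hQκ : QsOp Lc M₀ *ᵥ κ = fun _ => (Lc : ℂ) * κ' 0 := by
    funext y
    rw [← hκc y, hκ', mulVec_smul, Pi.smul_apply, smul_eq_mul]
    field_simp
  -- `⟨z, Sᴴt⟩ = ⟨S z, t⟩ = ⟨∂κ, t⟩ = ⟨κ, ∂ᴴt⟩ = ⟨κ, Q′ᴴψ⟩ = ⟨Q′κ, ψ⟩ = conj(Lc κ'(0)) Σ ψ = 0`
  rw [← conj_pairing, hsz, conj_pairing, ht, ← conj_pairing, hQκ]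
  simp only [dotProduct, Pi.star_apply]
  rw [← Finset.mul_sum, hψ, mul_zero]

variable {l : Type*} [Fintype l]

/-- **EXIT (iv′) ON TORI**: for every test-form matrix `T` whose rows have BLOCK-CONSTANT divergence (`(GradOp _ 1)ᴴ Tᴴ = Q′ᴴ Ψ` columnwise) the canonical read-outs of the
block-constrained covariance are Loewner-antitone under refinement. [folklore] -/
theorem blockMeanDiv_readOut_antitone (T : Matrix l (Tor (fine Lc M₀) × Fin d) ℂ) (Ψ : Matrix (Tor M₀) l ℂ)
    (hT : (GradOp (fine Lc M₀) 1)ᴴ * Tᴴ = (QsOp Lc M₀)ᴴ * Ψ) (j : ℕ) :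
    ((T * sread Lc (fine Lc M₀) j) * critCov (hform_isHermitian Lc (fine Lc M₀) j) (rows Lc (fine Lc M₀) (QvOp Lc M₀) j)
        * (T * sread Lc (fine Lc M₀) j)ᴴ
      - (T * sread Lc (fine Lc M₀) (j + 1)) * critCov (hform_isHermitian Lc (fine Lc M₀) (j + 1)) (rows Lc (fine Lc M₀) (QvOp Lc M₀) (j + 1))
        * (T * sread Lc (fine Lc M₀) (j + 1))ᴴ).PosSemidef := by
  have hTt : ∀ u : l → ℂ, (GradOp (fine Lc M₀) 1)ᴴ *ᵥ (Tᴴ *ᵥ u) = (QsOp Lc M₀)ᴴ *ᵥ (Ψ *ᵥ u) := by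
    intro u
    rw [mulVec_mulVec, mulVec_mulVec, hT]
  refine readOut_chain_torus Lc (fine Lc M₀) T (QvOp Lc M₀)
    (fun j => critCov (hform_isHermitian Lc (fine Lc M₀) j) (rows Lc (fine Lc M₀) (QvOp Lc M₀) j)) (fun _ => critCov_conjTranspose _ _)
    (fun j u => isCrit_critCov (hform_posSemidef Lc (fine Lc M₀) j) _ fun z hzR hzH => ?_) j
  rw [conjTranspose_mul, ← mulVec_mulVec]
  exact blockMeanDiv_source_legit Lc M₀ (Tᴴ *ᵥ u) (Ψ *ᵥ u) (hTt u) j z hzR hzH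

end BlockMean

end Summit.QuantumFields.BalabanUV.Beta.GAN24.MonotoneTorusBlockMean

end
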